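import Summits.SmoothPoincare4.SmoothPoincare4.Theses.CongruenceShadows

/-!
# Disproof work file for the crux `ShadowsStandard` (item stmt-SmoothPoincare4-14593)

Route `CongruenceShadows`, decl
`Summit.SmoothPoincare4.SmoothPoincare4.Theses.CongruenceShadows.ShadowsStandard`:
for every `m`, every `(3+3m, m+1)` group trisection `K` of the trivial group and every
characteristic finite-index `M ≤ S = S_{3+3m}` there is `ψ ∈ Aut S` with `ψ(Nᵢ)·M = Kᵢ·M`
(`N = s4Kernels.stabilizeIter m`, the standard balanced trisection of `S⁴`).

## Findings (cdisprove seat, cycle 1) — NO KILL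

1. **Where a counterexample must live** (`exists_nonstandard_of_not_shadowsStandard`): any
   failure of `ShadowsStandard` produces a `(3+3m; m+1)` group trisection of `{1}` that is NOT
   isomorphic (`TrisectionKernels.Iso`, automorphisms of `S_g` of either orientation) to the
   standard one at its own genus, i.e. — through Abrams–Gay–Kirby Thm 5 + Waldhausen — a
   balanced trisection of a homotopy 4-sphere that is not the standard trisection of `S⁴`:
   an exotic `S⁴` or a counterexample to Meier–Schirmer–Zupan's Conj. 3.11 ("every trisection
   of `S⁴` is standard"; arXiv:1507.06561). Equivalently `UnstableStandard → ShadowsStandard`.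
   Both are open; no certified non-standard balanced trisection of a homotopy sphere is known
   (Aranda–Zupan 2025, arXiv:2503.04607 p.27: "a major open problem"; their (3;1) candidates
   from tunnel-number-one knots in `S¹×S²` and from double branched covers of twist-spun
   2-bridge knots are CANDIDATES only). So the crux resists every cheap attack: it is implied by
   `SPC4 ∧ balanced-4d-Waldhausen` and a refutation would itself be a theorem of independent
   interest (a finite-group certificate of non-standardness).
2. **The computable kill criterion** (`homShadow_equiv_of_shadowStandardAt`,
   `card_homShadow_eq`): if the level-`M_Q` shadow of `K` is standard (`M_Q = ⋂ ker (S →* Q)`,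
   the cofinal family, `shadowsStandard_iff_levels`) then precomposition with `ψ` is a
   bijection of `Hom(S, Q)` carrying the labelling `φ ↦ (φ(K₀), φ(K₁), φ(K₂))` to
   `φ ↦ (φ(N₀), φ(N₁), φ(N₂))`; hence for every target triple `T` of subgroups of `Q` the
   counts `#{φ | ∀ i, φ(Kᵢ) = Tᵢ}` agree. A single finite group `Q` and a single kernel-form
   candidate `K` with different counts refutes the crux (and certifies `K` non-standard).
   For surjections onto a SIMPLE `Q` the counts are forced by the trisection axioms (normal
   subgroups `1, Q` only; pair quotients cyclic), so information can only come from proper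
   images / small solvable `Q`; the abelian images are governed by the Lagrangian triple,
   which is standard (hand proof in the rattack note = item AbelianShadowStandard).
3. **Load-bearing hypotheses**: dropping `IsGroupTrisection` is false (`shadowsStandard_false_without_trisection`,
   witness `K = ⊥`, `M = M_{ℤ/2}`); dropping `Characteristic` is false even for a RELABELLING of
   the standard trisection (`shadowsStandard_false_without_characteristic`, witness `K = N ∘ finRotate 3`,
   `M = ker(b₂ ↦ 1 ∈ ℤ/2)`); dropping `FiniteIndex` is EQUIVALENT to `UnstableStandard`
   (`shadowsStandardWithoutFiniteIndex_iff_unstableStandard`, via `M = ⊥`), i.e. to SPC4 ∧ balanced 4-d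
   Waldhausen in AGK's dictionary — open, not refutable here.
4. **Monotonicity** (`ShadowStandardAt.mono`): a standard shadow at a deeper characteristic
   level gives standard shadows at all shallower levels; with `levelSubgroup_le` this reduces
   the crux to the verbal levels `M_Q` (`shadowsStandard_iff_levels`).
5. Natural strengthening "one `ψ` for all `M`" is literally `UnstableStandard` (item 3).
   Natural strengthening "the level gate `A_M C_M ∩ B_M C_M = (A_M ∩ B_M) C_M` holds in
   `Aut S` for the level stabilisers" is FALSE already at the abelian level `M = [S,S]S²`,
   `g = 3` (Lagrangian `L = ⟨a₁, a₂+b₂, a₃+b₃⟩` meets `L₀, L₁` in dimension 1 each, like `L₂`,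
   but `L₀ ∩ L₁ ∩ L ≠ 0`): recorded informally only — the witness violates `L₀+L₁+L = H₁`, so it
   is not the shadow of a trisection of `{1}`; any levelwise proof must carry the
   homology-sphere side conditions (FKSZ) into each level.

6. §6: the computational attack (Aranda–Zupan loop surgeries → explicit `(3;1,1,1)` / `(4;1,1,2)` group
   trisections of `{1}`, shadows vs the standard: all equal so far; the genus-1 family is shown trivial; the real
   candidates = `α` twisted along a wavy meridian of `H_β` (tool ready, routing next cycle)). §1–§5 LANDED (p75004).
7. §7 (cycle 2): the `Hom(S,Q)` criterion is COMPLETE (`shadowStandardAt_level_iff`, HomSets.lean): level-`Q`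
   standardness = an orbit question for `Γ_Q = Im(Aut S_g → Sym Hom(S_g,Q))`; the K-FREE LEVEL GATE
   (`shadowStandardAt_of_levelGate`) decides the crux at `(m, M_Q)` for ALL `K` at once; computed at genus 3 with
   certified Lickorish generators of `Aut S_3`: GATE HOLDS at `ℤ/2`, `ℤ/3` (more levels pending on kit) ⇒ no genus-3
   kill exists at those levels; a failing level would be a formal fake shadow killing every K-free line there.

Everything below is sorry-free unless marked NEAR-MISS.
-/

noncomputable section

set_option linter.dupNamespace false

namespace Summit.SmoothPoincare4.SmoothPoincare4.Cruxes.ShadowsStandard.Disproof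

open Literature.Topology.FourManifolds Subgroup
open Summit.SmoothPoincare4.SmoothPoincare4.Theses.CongruenceShadows (ShadowsStandard)

/-! ## §0 Notation: the standard triple and level-wise standardness -/

/-- The standard balanced `(3+3m, m+1)` triple `N = s4Kernels.stabilizeIter m`. -/
abbrev N (m : ℕ) : TrisectionKernels (3 + 3 * m) := s4Kernels.stabilizeIter m

/-- "The shadow of `K` at level `M` is standard": some automorphism of `S` carries
`Nᵢ ⊔ M` to `Kᵢ ⊔ M` for all three `i`. -/
def ShadowStandardAt (m : ℕ) (K : TrisectionKernels (3 + 3 * m))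
    (M : Subgroup (SurfaceGroup (3 + 3 * m))) : Prop :=
  ∃ ψ : SurfaceGroup (3 + 3 * m) ≃* SurfaceGroup (3 + 3 * m),
    ∀ i : Fin 3, (N m i ⊔ M).map ψ.toMonoidHom = K i ⊔ M

/-- The crux, unfolded. -/
theorem shadowsStandard_iff :
    ShadowsStandard ↔ ∀ (m : ℕ) (K : TrisectionKernels (3 + 3 * m)),
      IsGroupTrisection (3 + 3 * m) (m + 1) (PUnit : Type) K →
      ∀ M : Subgroup (SurfaceGroup (3 + 3 * m)), M.Characteristic → M.FiniteIndex →
        ShadowStandardAt m K M :=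
  Iff.rfl

/-- The standard triple is a group trisection of the trivial group at every `m` (the crux's
hypotheses are satisfiable; from the two discharged tree facts). -/
theorem stabilizeIter_isGroupTrisection (m : ℕ) :
    IsGroupTrisection (3 + 3 * m) (m + 1) (PUnit : Type) (N m) := by
  induction m with
  | zero => exact s4Kernels_isGroupTrisection_holds
  | succ m ih => exact stabilize_isGroupTrisection_holds (3 + 3 * m) (m + 1) PUnit (N m) ih

/-! ## §1 Where a counterexample must live: `UnstableStandard → ShadowsStandard` -/

/-- Every balanced `(3+3m, m+1)` group trisection of the trivial group is isomorphic, at its own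
genus, to the standard one. In AGK's dictionary: every balanced trisection of every homotopy
4-sphere is (possibly orientation-reversingly) diffeomorphic to the standard trisection of `S⁴`
— i.e. `SPC4 ∧` "every balanced trisection of `S⁴` is standard" (MSZ Conj. 3.11, balanced). -/
def UnstableStandard : Prop :=
  ∀ (m : ℕ) (K : TrisectionKernels (3 + 3 * m)),
    IsGroupTrisection (3 + 3 * m) (m + 1) (PUnit : Type) K → TrisectionKernels.Iso (N m) K

/-- An isomorphism of triples gives standard shadows at every characteristic level. -/
theorem ShadowStandardAt.of_iso {m : ℕ} {K : TrisectionKernels (3 + 3 * m)}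
    (h : TrisectionKernels.Iso (N m) K) (M : Subgroup (SurfaceGroup (3 + 3 * m)))
    (hM : M.Characteristic) : ShadowStandardAt m K M := by
  obtain ⟨α, hα⟩ := h
  refine ⟨α, fun i => ?_⟩
  rw [Subgroup.map_sup, hα i, (characteristic_iff_map_eq.1 hM) α]

/-- `UnstableStandard → ShadowsStandard`. -/
theorem shadowsStandard_of_unstableStandard (h : UnstableStandard) : ShadowsStandard :=
  fun m K hK M hM _ => ShadowStandardAt.of_iso (h m K hK) M hM

/-- **Why the crux resists.** A failure of `ShadowsStandard` exhibits a balanced group trisection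
of the trivial group not isomorphic to the standard one at its genus (an exotic 4-sphere or a
non-standard balanced trisection of `S⁴`). -/
theorem exists_nonstandard_of_not_shadowsStandard (h : ¬ ShadowsStandard) :
    ∃ (m : ℕ) (K : TrisectionKernels (3 + 3 * m)),
      IsGroupTrisection (3 + 3 * m) (m + 1) (PUnit : Type) K ∧ ¬ TrisectionKernels.Iso (N m) K := by
  by_contra hne
  push Not at hne
  exact h (shadowsStandard_of_unstableStandard fun m K hK => hne m K hK)

/-! ## §2 The verbal levels `M_Q` and monotonicity -/

/-- The level subgroup of a target group `Q`: `M_Q = ⋂ {ker φ | φ : S_g →* Q}`. -/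
def levelSubgroup (g : ℕ) (Q : Type*) [Group Q] : Subgroup (SurfaceGroup g) :=
  ⨅ φ : SurfaceGroup g →* Q, φ.ker

/-- `M_Q ≤ ker φ` for every `φ : S_g →* Q`. [folklore] -/
theorem levelSubgroup_le_ker {g : ℕ} {Q : Type*} [Group Q] (φ : SurfaceGroup g →* Q) :
    levelSubgroup g Q ≤ φ.ker :=
  iInf_le _ φ

/-- `M_Q` is characteristic (automorphisms permute `Hom(S, Q)`). -/
theorem levelSubgroup_characteristic (g : ℕ) (Q : Type*) [Group Q] :
    (levelSubgroup g Q).Characteristic := by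
  rw [characteristic_iff_le_comap]
  intro ϕ x hx
  rw [mem_comap]
  refine mem_iInf.2 fun φ => ?_
  exact mem_iInf.1 hx (φ.comp ϕ.toMonoidHom)

/-- Homomorphisms out of `S_g` are determined by the `2g` generators, so `Hom(S_g, Q)` is finite
for finite `Q`. -/
instance finite_hom (g : ℕ) (Q : Type*) [Group Q] [Finite Q] : Finite (SurfaceGroup g →* Q) :=
  Finite.of_injective (fun φ : SurfaceGroup g →* Q => fun x : surfaceGen g => φ (PresentedGroup.of x))
    fun _ _ h => PresentedGroup.ext fun x => congrFun h x

/-- `M_Q` has finite index for finite `Q`. -/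
theorem levelSubgroup_finiteIndex (g : ℕ) (Q : Type*) [Group Q] [Finite Q] :
    (levelSubgroup g Q).FiniteIndex := by
  unfold levelSubgroup
  exact finiteIndex_iInf fun φ => inferInstance

/-- `M_{S/M} ≤ M`: the verbal levels are cofinal among normal finite-index subgroups. -/
theorem levelSubgroup_quotient_le {g : ℕ} (M : Subgroup (SurfaceGroup g)) [M.Normal] :
    levelSubgroup g (SurfaceGroup g ⧸ M) ≤ M := by
  refine (levelSubgroup_le_ker (QuotientGroup.mk' M)).trans ?_
  rw [QuotientGroup.ker_mk']

/-- **Monotonicity.** A standard shadow at level `M'` gives a standard shadow at every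
characteristic level `M ⊇ M'` (no hypothesis on `M'`). -/
theorem ShadowStandardAt.mono {m : ℕ} {K : TrisectionKernels (3 + 3 * m)}
    {M' M : Subgroup (SurfaceGroup (3 + 3 * m))} (hle : M' ≤ M) (hM : M.Characteristic)
    (h : ShadowStandardAt m K M') : ShadowStandardAt m K M := by
  obtain ⟨ψ, hψ⟩ := h
  refine ⟨ψ, fun i => ?_⟩
  have e1 : N m i ⊔ M = (N m i ⊔ M') ⊔ M := by
    rw [sup_assoc, sup_eq_right.2 hle]
  have e2 : K i ⊔ M = (K i ⊔ M') ⊔ M := by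
    rw [sup_assoc, sup_eq_right.2 hle]
  rw [e1, e2, Subgroup.map_sup, hψ i, (characteristic_iff_map_eq.1 hM) ψ]

/-- **Reduction to verbal levels.** The crux is equivalent to its restriction to the levels
`M_Q`, `Q` a finite group (in `Type`). -/
theorem shadowsStandard_iff_levels :
    ShadowsStandard ↔ ∀ (m : ℕ) (K : TrisectionKernels (3 + 3 * m)),
      IsGroupTrisection (3 + 3 * m) (m + 1) (PUnit : Type) K →
      ∀ (Q : Type) [Group Q] [Finite Q], ShadowStandardAt m K (levelSubgroup _ Q) := by
  constructor
  · intro h m K hK Q _ _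
    exact h m K hK _ (levelSubgroup_characteristic _ Q) (levelSubgroup_finiteIndex _ Q)
  · intro h m K hK M hM hMf
    haveI := hMf
    haveI := hM
    haveI : M.Normal := inferInstance
    exact (h m K hK (SurfaceGroup (3 + 3 * m) ⧸ M)).mono (levelSubgroup_quotient_le M) hM

/-! ## §3 The computable kill criterion: `Hom(S,Q)`-labellings -/

/-- **Kill criterion.** If the shadow of `K` at level `M_Q` is standard then precomposition with
the automorphism is a bijection `e` of `Hom(S_g, Q)` with `φ(Kᵢ) = (e φ)(Nᵢ)` for all `φ, i`: the
labelled sets `(Hom(S,Q), φ ↦ (φ(Kᵢ))ᵢ)` for `K` and for `N` are isomorphic. -/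
theorem homShadow_equiv_of_shadowStandardAt {m : ℕ} {K : TrisectionKernels (3 + 3 * m)}
    {Q : Type*} [Group Q] (h : ShadowStandardAt m K (levelSubgroup _ Q)) :
    ∃ e : (SurfaceGroup (3 + 3 * m) →* Q) ≃ (SurfaceGroup (3 + 3 * m) →* Q),
      ∀ (φ : SurfaceGroup (3 + 3 * m) →* Q) (i : Fin 3),
        (K i).map φ = (N m i).map (e φ) := by
  obtain ⟨ψ, hψ⟩ := h
  refine ⟨⟨fun φ => φ.comp ψ.toMonoidHom, fun φ => φ.comp ψ.symm.toMonoidHom, fun φ => ?_,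
    fun φ => ?_⟩, fun φ i => ?_⟩
  · ext x; simp
  · ext x; simp
  · have hK : (levelSubgroup _ Q).map φ = ⊥ := (Subgroup.map_eq_bot_iff _).2 (levelSubgroup_le_ker φ)
    have hN : (levelSubgroup _ Q).map (φ.comp ψ.toMonoidHom) = ⊥ :=
      (Subgroup.map_eq_bot_iff _).2 (levelSubgroup_le_ker _)
    change (K i).map φ = (N m i).map (φ.comp ψ.toMonoidHom)
    calc (K i).map φ = (K i ⊔ levelSubgroup _ Q).map φ := by rw [Subgroup.map_sup, hK, sup_bot_eq]
      _ = ((N m i ⊔ levelSubgroup _ Q).map ψ.toMonoidHom).map φ := by rw [hψ i]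
      _ = (N m i).map (φ.comp ψ.toMonoidHom) := by rw [Subgroup.map_map, Subgroup.map_sup, hN, sup_bot_eq]

/-- **Counting form of the kill criterion.** Standard shadow at level `M_Q` forces, for every
target triple `T` of subgroups of `Q`, equality of the numbers of homomorphisms `S_g → Q` mapping
`(K₀,K₁,K₂)`, resp. `(N₀,N₁,N₂)`, exactly onto `T`. (By Möbius inversion over the subgroup
lattice this is the same information as the Hall-type counts `#{φ | φ(Kᵢ) ≤ Tᵢ}`.) A candidate
`K` and a finite `Q` with ONE differing count refute the crux via `shadowsStandard_iff_levels`. -/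
theorem card_homShadow_eq {m : ℕ} {K : TrisectionKernels (3 + 3 * m)}
    {Q : Type*} [Group Q] (h : ShadowStandardAt m K (levelSubgroup _ Q))
    (T : Fin 3 → Subgroup Q) :
    Nat.card {φ : SurfaceGroup (3 + 3 * m) →* Q // ∀ i, (K i).map φ = T i} =
      Nat.card {φ : SurfaceGroup (3 + 3 * m) →* Q // ∀ i, (N m i).map φ = T i} := by
  obtain ⟨e, he⟩ := homShadow_equiv_of_shadowStandardAt h
  refine Nat.card_congr (e.subtypeEquiv fun φ => ?_)
  simp only [he]

/-! ## §4 Load-bearing hypotheses -/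

/-- Homomorphisms from `S_g` to a commutative group are free on the generators: the surface
relator dies. -/
theorem lift_surfaceRelator_eq_one {g : ℕ} {Q : Type*} [CommGroup Q] (f : surfaceGen g → Q) :
    FreeGroup.lift f (surfaceRelator g) = 1 := by
  unfold surfaceRelator
  rw [map_list_prod, List.map_map]
  apply List.prod_eq_one
  intro x hx
  rw [List.mem_map] at hx
  obtain ⟨i, -, rfl⟩ := hx
  simp only [Function.comp_apply, map_mul, map_inv, genA, genB, FreeGroup.lift_apply_of]
  rw [mul_inv_eq_one, mul_inv_eq_iff_eq_mul, mul_comm]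

/-- The homomorphism `S_g →* Q` (`Q` commutative) with prescribed values on the generators. -/
def abelianHom {g : ℕ} {Q : Type*} [CommGroup Q] (f : surfaceGen g → Q) : SurfaceGroup g →* Q :=
  PresentedGroup.toGroup (f := f) (by
    intro r hr
    rw [Set.mem_singleton_iff] at hr
    subst hr
    exact lift_surfaceRelator_eq_one f)

/-- `abelianHom f` on a generator. [folklore] -/
@[simp] theorem abelianHom_of {g : ℕ} {Q : Type*} [CommGroup Q] (f : surfaceGen g → Q)
    (x : surfaceGen g) : abelianHom f (PresentedGroup.of x) = f x :=
  PresentedGroup.toGroup.of _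

/-- The character `χ_u : S_g → ℤ/2` that is `1` on the generator `u` and `0` on the others. -/
def genChar {g : ℕ} (u : surfaceGen g) : SurfaceGroup g →* Multiplicative (ZMod 2) :=
  abelianHom fun x => if x = u then Multiplicative.ofAdd 1 else 1

/-- `χ_u(u) = 1 ∈ ℤ/2` (written multiplicatively). [folklore] -/
theorem genChar_of_self {g : ℕ} (u : surfaceGen g) :
    genChar u (PresentedGroup.of u) = Multiplicative.ofAdd 1 := by
  simp [genChar]

/-- `χ_u(x) = 0` for generators `x ≠ u`. [folklore] -/
theorem genChar_of_ne {g : ℕ} {u x : surfaceGen g} (h : x ≠ u) :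
    genChar u (PresentedGroup.of x) = 1 := by
  simp [genChar, h]

/-- The generator `u` is not in `ker χ_u`. [folklore] -/
theorem of_not_mem_ker_genChar {g : ℕ} (u : surfaceGen g) :
    (PresentedGroup.of u : SurfaceGroup g) ∉ (genChar u).ker := by
  rw [MonoidHom.mem_ker, genChar_of_self]
  decide

/-- Every generator of `S_3` lies in one of the three standard kernels, so the standard kernels
generate `S_3`. -/
theorem iSup_s4Kernels_eq_top : (⨆ i, s4Kernels i) = ⊤ := by
  rw [eq_top_iff, ← PresentedGroup.closure_range_of, closure_le]
  rintro _ ⟨x, rfl⟩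
  obtain ⟨i, hi⟩ := s4Gens_cover x
  exact mem_iSup_of_mem i (of_mem_s4Kernels i hi)

/-- The level `M_{ℤ/2}` of `S_3` is a PROPER subgroup. -/
theorem levelSubgroup_zmod2_ne_top : levelSubgroup 3 (Multiplicative (ZMod 2)) ≠ ⊤ := by
  intro h
  have hmem : (PresentedGroup.of ((0 : Fin 3), true) : SurfaceGroup 3) ∈
      levelSubgroup 3 (Multiplicative (ZMod 2)) := by rw [h]; exact mem_top _
  exact of_not_mem_ker_genChar _ (levelSubgroup_le_ker (genChar ((0 : Fin 3), true)) hmem)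

/-- The crux with the hypothesis `IsGroupTrisection … K` DROPPED. -/
def ShadowsStandardWithoutTrisection : Prop :=
  ∀ (m : ℕ) (K : TrisectionKernels (3 + 3 * m)) (M : Subgroup (SurfaceGroup (3 + 3 * m))),
    M.Characteristic → M.FiniteIndex → ShadowStandardAt m K M

/-- **`IsGroupTrisection` is load-bearing**: for the junk triple `K = ⊥` at `m = 0` and the proper
characteristic finite-index level `M = M_{ℤ/2}`, a standard shadow would force `Nᵢ ≤ M` for all
`i`, hence `M = ⊤`. -/
theorem shadowsStandard_false_without_trisection : ¬ ShadowsStandardWithoutTrisection := by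
  intro h
  obtain ⟨ψ, hψ⟩ := h 0 (fun _ => ⊥) (levelSubgroup 3 (Multiplicative (ZMod 2)))
    (levelSubgroup_characteristic 3 _) (levelSubgroup_finiteIndex 3 _)
  apply levelSubgroup_zmod2_ne_top
  rw [eq_top_iff, ← iSup_s4Kernels_eq_top, iSup_le_iff]
  intro i
  have hi := hψ i
  rw [bot_sup_eq] at hi
  have key : s4Kernels i ⊔ levelSubgroup 3 (Multiplicative (ZMod 2)) =
      levelSubgroup 3 (Multiplicative (ZMod 2)) := by
    have := congrArg (Subgroup.comap ψ.toMonoidHom) hi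
    rwa [comap_map_eq_self_of_injective ψ.injective,
      (levelSubgroup_characteristic 3 (Multiplicative (ZMod 2))).fixed ψ] at this
  exact le_sup_left.trans key.le

/-- The crux with `M.FiniteIndex` DROPPED. -/
def ShadowsStandardWithoutFiniteIndex : Prop :=
  ∀ (m : ℕ) (K : TrisectionKernels (3 + 3 * m)),
    IsGroupTrisection (3 + 3 * m) (m + 1) (PUnit : Type) K →
    ∀ M : Subgroup (SurfaceGroup (3 + 3 * m)), M.Characteristic → ShadowStandardAt m K M

/-- **`FiniteIndex` is load-bearing but not refutable here**: without it the statement is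
EQUIVALENT to `UnstableStandard` (take `M = ⊥`), i.e. to SPC4 ∧ balanced 4-d Waldhausen. -/
theorem shadowsStandardWithoutFiniteIndex_iff_unstableStandard :
    ShadowsStandardWithoutFiniteIndex ↔ UnstableStandard := by
  constructor
  · intro h m K hK
    obtain ⟨ψ, hψ⟩ := h m K hK ⊥ Subgroup.botCharacteristic
    exact ⟨ψ, fun i => by simpa using hψ i⟩
  · intro h m K hK M hM
    exact ShadowStandardAt.of_iso (h m K hK) M hM

/-- The crux with `M.Characteristic` DROPPED (so `ψ` need not preserve `M`). -/
def ShadowsStandardWithoutCharacteristic : Prop :=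
  ∀ (m : ℕ) (K : TrisectionKernels (3 + 3 * m)),
    IsGroupTrisection (3 + 3 * m) (m + 1) (PUnit : Type) K →
    ∀ M : Subgroup (SurfaceGroup (3 + 3 * m)), M.FiniteIndex → ShadowStandardAt m K M

/-- Relabelling the three kernels of a group trisection gives a group trisection. -/
theorem isGroupTrisection_reindex {g k : ℕ} {G : Type*} [Group G] {K : TrisectionKernels g}
    (hK : IsGroupTrisection g k G K) (σ : Equiv.Perm (Fin 3)) :
    IsGroupTrisection g k G (K ∘ σ) where
  normal i := hK.normal (σ i)
  free_quotient i := hK.free_quotient (σ i)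
  free_pairQuotient i j hij := hK.free_pairQuotient (σ i) (σ j) (σ.injective.ne hij)
  triple := by
    obtain ⟨e⟩ := hK.triple
    have hU : (⋃ i, ((K ∘ σ) i : Set (SurfaceGroup g))) = ⋃ i, (K i : Set (SurfaceGroup g)) :=
      σ.surjective.iUnion_comp fun i => (K i : Set (SurfaceGroup g))
    exact ⟨(QuotientGroup.quotientMulEquivOfEq (congrArg normalClosure hU)).trans e⟩

/-- The relabelled standard triple `N ∘ finRotate 3 = (N₁, N₂, N₀)` of genus `3`. -/
def rotatedKernels : TrisectionKernels 3 := s4Kernels ∘ finRotate 3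

/-- The relabelled standard triple is a `(3,1)` group trisection of the trivial group. [folklore] -/
theorem rotatedKernels_isGroupTrisection : IsGroupTrisection 3 1 (PUnit : Type) rotatedKernels :=
  isGroupTrisection_reindex s4Kernels_isGroupTrisection_holds _

/-- `N₀ = ⟪a₁, a₂, b₃⟫` dies under the character of `b₂`. -/
theorem s4Kernels_zero_le_ker : s4Kernels 0 ≤ (genChar (((1 : Fin 3), true) : surfaceGen 3)).ker := by
  rw [s4Kernels_eq]
  refine normalClosure_le_normal ?_
  rintro _ ⟨x, hx, rfl⟩
  rw [SetLike.mem_coe, MonoidHom.mem_ker]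
  refine genChar_of_ne ?_
  rintro rfl
  revert hx
  decide

/-- `N₁ ⊔ ker χ_{b₂} = ⊤`: `b₂ ∈ N₁ = ⟪a₁, b₂, a₃⟫`, every other generator dies under `χ_{b₂}`. -/
theorem s4Kernels_one_sup_ker_eq_top :
    s4Kernels 1 ⊔ (genChar (((1 : Fin 3), true) : surfaceGen 3)).ker = ⊤ := by
  rw [eq_top_iff, ← PresentedGroup.closure_range_of, closure_le]
  rintro _ ⟨x, rfl⟩
  by_cases hx : x = ((1 : Fin 3), true)
  · subst hx
    exact mem_sup_left (of_mem_s4Kernels 1 (by decide))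
  · exact mem_sup_right (by rw [MonoidHom.mem_ker]; exact genChar_of_ne hx)

/-- **`Characteristic` is load-bearing**: for the relabelled STANDARD trisection
`K = (N₁, N₂, N₀)` (isomorphic to `N`, so all its characteristic shadows are standard) and the
non-characteristic index-2 level `M = ker χ_{b₂}`, no automorphism works: at `i = 0` the left
side `ψ(N₀ ⊔ M) = ψ(M)` is proper while the right side `N₁ ⊔ M` is everything. -/
theorem shadowsStandard_false_without_characteristic : ¬ ShadowsStandardWithoutCharacteristic := by
  intro h
  obtain ⟨ψ, hψ⟩ := h 0 rotatedKernels rotatedKernels_isGroupTrisection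
    (genChar (((1 : Fin 3), true) : surfaceGen 3)).ker inferInstance
  have h0 := hψ 0
  have hl : s4Kernels.stabilizeIter 0 0 ⊔ (genChar (((1 : Fin 3), true) : surfaceGen 3)).ker =
      (genChar (((1 : Fin 3), true) : surfaceGen 3)).ker :=
    sup_eq_right.2 s4Kernels_zero_le_ker
  have hr : rotatedKernels 0 ⊔ (genChar (((1 : Fin 3), true) : surfaceGen 3)).ker = ⊤ :=
    s4Kernels_one_sup_ker_eq_top
  rw [hl, hr] at h0
  have htop : (genChar (((1 : Fin 3), true) : surfaceGen 3)).ker = ⊤ := by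
    have := congrArg (Subgroup.comap ψ.toMonoidHom) h0
    rwa [comap_map_eq_self_of_injective ψ.injective, comap_top] at this
  exact of_not_mem_ker_genChar _ (htop ▸ mem_top (PresentedGroup.of (((1 : Fin 3), true) : surfaceGen 3)))

/-! ## §5 Natural strengthenings -/

/-- The uniform strengthening "one automorphism for all levels" is literally `UnstableStandard`
(specialise to `M = ⊥`); recorded as an `Iff` with the `M`-uniform statement. -/
theorem uniform_iff_unstableStandard :
    (∀ (m : ℕ) (K : TrisectionKernels (3 + 3 * m)),
      IsGroupTrisection (3 + 3 * m) (m + 1) (PUnit : Type) K →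
      ∃ ψ : SurfaceGroup (3 + 3 * m) ≃* SurfaceGroup (3 + 3 * m),
        ∀ M : Subgroup (SurfaceGroup (3 + 3 * m)), M.Characteristic →
          ∀ i : Fin 3, (N m i ⊔ M).map ψ.toMonoidHom = K i ⊔ M) ↔ UnstableStandard := by
  constructor
  · intro h m K hK
    obtain ⟨ψ, hψ⟩ := h m K hK
    exact ⟨ψ, fun i => by simpa using hψ ⊥ Subgroup.botCharacteristic i⟩
  · intro h m K hK
    obtain ⟨α, hα⟩ := h m K hK
    exact ⟨α, fun M hM i => by rw [Subgroup.map_sup, hα i, (characteristic_iff_map_eq.1 hM) α]⟩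

/-! ## §6 Computational attack (m = 0, 1) — the kill path in practice (cycle 1 log)

LANDED: the §1–§5 lemmas are in the tree as
`Summits/SmoothPoincare4/SmoothPoincare4/Theorems/ShadowsStandard/Negative/ShadowLevels.lean` (p75004,
commit bd2dca82718d; namespace `…Theorems.ShadowsStandard.Negative`: `ShadowStandardAt`, `levelSubgroup`,
`exists_nonstandard_of_not_shadowsStandard`, `homShadow_equiv_of_shadowStandardAt`, `card_homShadow_eq`,
`shadowsStandard_false_without_trisection`, `shadowsStandard_false_without_characteristic`,
`shadowsStandard_without_finiteIndex_iff_unstable`, `shadowsStandard_uniform_iff_unstable`). Importable by ideators.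

Pipeline (folder `comp/`, attached as evidence `shadow_pipeline.zip`; no Lean content):

* `s3kit.py`: words in `S_3 = ⟨a₁,a₂,a₃,b₁,b₂,b₃ ∣ [a₁,b₁][a₂,b₂][a₃,b₃]⟩`, Dehn's algorithm, verified automorphisms
  (`T_{aᵢ}`, `T_{bᵢ}`, handle rotation, separating twist; 248 polygon-model twist substitutions found by exhaustive
  search, `find_twists.py`), enumeration of `Hom(⟨n gens ∣ W⟩, Q)` for permutation groups `Q` (generic one-relator
  solver; |Hom(S_3,S₃)| = 16038 reproduces the rattack figure) and the labelling counter
  `T_Q(K) = multiset over φ of (φ(K₀), φ(K₁), φ(K₂))` of §3 (`card_homShadow_eq`): `T_Q(K) ≠ T_Q(N)` for ONE `Q`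
  refutes the crux (via `shadowsStandard_levels`). `T_Q` is invariant under isomorphisms of the source group, so a
  candidate given in ANY presentation is compared directly with `N` — no normalisation to `∏[aᵢ,bᵢ]` needed.
  Validated: equal for `N`, `N ∘ finRotate 3`, `rot(N)`, `T_{a₁}(N)`; different for a junk triple.
* `surg.py` (genus 3) / `surg2.py` (genus 4): Aranda–Zupan "surgery on a decomposed curve" (arXiv:2503.04607 §5
  Thm 5.1, Rem 5.2, §8) on the genus-ONE `(T²; μ,μ,μ)` resp. genus-TWO `(Σ₂; α, β, β)` = `(2;1,1,2)` trisection of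
  `S¹×S³`: explicit planar polylines (torus chart, tube/annulus chart, pants chart), `π₁` by the dual-graph method
  (cut graph `G` with `Σ ∖ G` one disc — verified by face tracing + Euler characteristic + embedding self-check),
  curve words = signed crossing sequences, Tietze to `2g` generators / 1 relator. SANITY (all candidates pass):
  `|Hom(⟨W⟩,Q)|` = surface-group value, handlebody quotients free of the right rank (`|Q|^g`), pair quotients
  (`|Q|^{k}`), triple quotient trivial — i.e. genuine group trisections of `{1}` = trisections of `S⁴`
  (`(3;1,1,1)` at genus 3; `(4;1,1,2)` at genus 4, compared with the standard unbalanced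
  `N⁽⁴⁾ = (⟪a₁,a₂,b₃,b₄⟫, ⟪a₁,b₂,a₃,a₄⟫, ⟪b₁,a₂,a₃,a₄⟫)`).
* `twist.py` / `surg2t.py`: WORD-LEVEL Dehn twists (insert the cyclic word of δ read from each crossing point),
  the `H_β`-word / `H_α`-word of a curve (meridian test by Dehn's lemma; knot-group relator
  `π₁(S¹×S² ∖ K) = ⟨x₁,x₂ ∣ w_α(τ_δⁿ β₂)⟩`).

RESULTS (cycle 1) — NO KILL:
* genus 3, genus-1-based family: 15 winding variants + 18 immersed "lasso/zigzag" designs — all `T_Q = T_Q(N)` for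
  `Q ∈ {S₃, D₄, Q₈}` (an `A₄` kit job, j009624, was cancelled as moot once the family was understood). EXPLAINED: this family is
  trivial up to diagram moves — a lasso of the type-i arc around the third junction is a handle slide over a type-i
  curve (`C_ab = γ'₀`, `C_bc = α'₀`, `C_ca = β'₀`), windings are Dehn twists of the whole configuration along
  `μ`-parallel curves (diffeomorphisms), zigzags across allowed walls are bigon isotopies; so every member is
  (presumably) the standard genus-3 trisection of `S⁴` — a strong end-to-end validation, not a candidate source.
* genus 4, genus-2-based `(4;1,1,2)` designs `c0` (plain), `c1` (one tube traversal): genuine trisections of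
  `S⁴`, `T_{S₃}` = standard. EXPLAINED: with `H_α`, `H_β` the standard (reducible) genus-2 splitting of `S¹×S²`
  and `ℓ` dual to `β₁`, disjoint from `β₂`, the tunnel-number-one knot `K = ℓ ⊂ H_β` has
  `π₁(E(K)) = F(x₁,x₂)/⟪w_α(β₂)⟫ = ℤ` (light bulb: core knot) — all such data give the trivial knot.
* WHERE THE REAL CANDIDATES ARE (Aranda–Zupan p. 27 "strong candidates", made precise): keep `(α, β, γ, ℓ₀)`
  standard but replace `α` by `τ_δ^{-n}(α)` for a MERIDIAN `δ` of `H_β` (H_β-word freely trivial) meeting `β₂`;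
  then `K` has group `⟨x₁,x₂ ∣ w_α(τ_δⁿ β₂)⟩`, non-cyclic iff the two arcs `A`, `B` of `δ` between consecutive
  `β₂`-crossings have NON-COMMUTING `x`-words (checked: every band sum `β₁ #_ε β₂` fails this — conjugates of `x₂`
  only; the design `d1` = `y₁[x₁x₂x₁⁻¹]y₁⁻¹ · y₂[x₂]y₂⁻¹` passes it). The data `(τ_δ^{-n}α, β, γ, ℓ₀)` is again a
  `(2;1,1,2)` trisection of `S¹×S³` with `ℓ₀` surgering to `S⁴` (τ_δ preserves `H_β = H_γ`, `[wall]·δ = 0`), all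
  computable at the word level (`surg2t.py`); only the planar routing of `d1` (tube discs r = 0.03 too small for
  four distinct tube angles) is unfinished — NEXT CYCLE, with `RT = 0.05`.
* THEORY NOTES for provers: `T_Q` is forced by the axioms on surjections onto SIMPLE `Q` (normal subgroups `1, Q`;
  pair quotients cyclic), so `A₅, PSL₂(7), …` add nothing beyond their proper subgroups; and if every balanced
  trisection of a homotopy sphere is `(N₀, N₁, βN₂)` with `β` in the Johnson kernel (Lambert-Cole-type
  regluing, cited by the route), then `T_Q` is standard for all NILPOTENT `Q` of class ≤ 2 (β acts trivially on
  `S/γ₃S`). Informative levels are small non-nilpotent solvable `Q`: `S₃, A₄, D₅, Dic₃, SL₂(3), S₄, F₂₁, …`.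
-/

/-! ## §7 Cycle 2 (cdisprove g2): the `Hom(S,Q)` criterion is COMPLETE; the K-free LEVEL GATE at genus 3

### 7.1 New Lean (folder `HomSets.lean`, proposed as `Theorems/ShadowsStandard/Negative/HomSets.lean`,
namespace `…Theorems.ShadowsStandard.Negative`; lean check rc 0, 0 sorry; proposal p77782)

* `exists_section_of_free`, `sup_levelSubgroup_eq_iInf_ker`: for a normal `P ≤ S_g` with FREE quotient (every
  handlebody kernel, every pair product `KᵢKⱼ` of a group trisection) and every group `Q`,
  `P ⊔ M_Q = ⋂ {ker φ | φ : S_g →* Q, φ(P) = 1}` — split `S ↠ S/P` and write `x = (x·s(x̄)⁻¹)·s(x̄)`.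
* `shadowStandardAt_level_iff` (+ `_of_isGroupTrisection`): **completeness** —
  `ShadowStandardAt m K M_Q ⟺ ∃ ψ ∈ Aut S, ∀ i φ, (Kᵢ ≤ ker φ ↔ Nᵢ ≤ ker (φ ∘ ψ))`.
  So standardness at level `Q` is EXACTLY an orbit question for the finite permutation group
  `Γ_Q = Im(Aut S_g → Sym(Hom(S_g,Q)))` acting on triples of "killer sets" `E_Q(P) = {φ | φ(P)=1}`; cycle 1 had `⟹` only
  (`homShadow_equiv_of_shadowStandardAt`). One may quotient `Hom(S,Q)` by `Aut Q` (killer sets are `Aut Q`-stable).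
* `ShadowStandardAt.comp_iso` / `iso_invariant`, `isGroupTrisection_map_equiv` (AGK's `IsGroupTrisection` is invariant
  under `Aut S_g` — ideator 3 had to assume this), `eq_one_of_le_ker` (triple condition: a hom killing the three kernels
  of a trisection of `{1}` is trivial), `pair_transport`.
* `levelGate_standard`, `shadowStandardAt_of_levelGate`: the **K-free level gate** at a characteristic level `M` —
  for all `a, b ∈ Aut S` with `a(N₀) = N₀`, `b(N₁) = N₁`, `a(N₂) ⊔ M = b(N₂) ⊔ M` and the triple condition for
  `(N₀, N₁, a(N₂))` w.r.t. a test group `T`, some `y` fixes `N₀ ⊔ M`, `N₁ ⊔ M` and has `y(N₂ ⊔ M) = a(N₂) ⊔ M` —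
  IMPLIES `ShadowStandardAt m K M` for EVERY group trisection `K` of `{1}` whose pairs are standard (the conclusion of
  `WaldhausenPairs` for `K`; normalise `(K₀,K₁)` to `(N₀,N₁)`). Contrapositive = the disprover's guide: a genus-`g`
  kill at level `M` needs the K-free gate to FAIL at `M` (a "formal fake shadow") AND an honest realisation.

### 7.2 The computation (m = 0, genus 3; folder `comp/`: `sg.py`, `groups.py`, `homs.py`, `gatejob/{run.sh,gate.g}`; GAP 4.12 on kit)

Generators of `Aut S_3` (`S_3 = ⟨a₁,b₁,a₂,b₂,a₃,b₃ ∣ R = [a₁,b₁][a₂,b₂][a₃,b₃]⟩`, `[x,y] = xyx⁻¹y⁻¹`, tree convention):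
the LICKORISH twists `T_{aᵢ}: bᵢ ↦ bᵢaᵢ`, `T_{bᵢ}: aᵢ ↦ aᵢbᵢ`, the chain twists
`T_{c₁}: b₁ ↦ c b₁, a₂ ↦ c a₂ c⁻¹, b₂ ↦ b₂ c⁻¹` with `c = b₁a₁⁻¹b₁⁻¹a₂` (the diagonal `v₁ → v₅` of the 12-gon, class
`a₂ − a₁`; derived from the cyclic order of edge germs `a₁⁺ b₁⁻ a₁⁻ b₁⁺ a₂⁺ b₂⁻ a₂⁻ b₂⁺ a₃⁺ b₃⁻ a₃⁻ b₃⁺` around the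
vertex: `c` pushed to the side `{b₁⁺,a₂⁺,b₂⁻,a₂⁻}` crosses `b₁` at its start, `a₂` at both ends, `b₂` at its end) and
`T_{c₂} = ρ T_{c₁} ρ⁻¹` (`ρ` = handle rotation), the orientation reversal `ι: a₁↔b₃, b₁↔a₃, a₂↔b₂` (`R ↦ R⁻¹`), and
`Inn S_3` (acts trivially on `Hom/Aut Q`). CHECKED mechanically: every generator maps `R` to `R^{±1}` letter for letter
(not merely up to conjugacy), `T_{c₁}` is invertible with `T_{c₁}(c) = c`. By Lickorish 1964 (twists about
`aᵢ, bᵢ, cᵢ` generate `Mod(Σ₃)`; our `(aᵢ,bᵢ,cᵢ)` have the chain intersection pattern `i(aᵢ,bᵢ)=1`,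
`i(c_i,b_i)=i(c_i,b_{i+1})=1`, all other pairs disjoint) + Dehn–Nielsen–Baer, these generate ALL of `Aut S_3`.
VALIDATION: `|Γ_{ℤ/2}|` on the `135` Lagrangians of `F₂⁶` is `1451520 = |Sp(6,2)|`; `|Γ_{ℤ/3}|` on the `1120`
Lagrangians of `F₃⁶` is `9170703360 = |Sp(6,3)| = |PGSp^±(6,3)|`; `|Hom(S_3,S₃)| = 16038`, `/Aut S₃ = 2948 = 365 + 63·41`;
`|Stab L₀ ∩ Stab L₁| = 192` in `Sp(6,2)` = triager 2's independent `F₂` enumeration of `Im(A∩B)`.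

For each finite `Q`: points = `Hom(S_3,Q)/Aut Q`; `xᵢ = E(Nᵢ)`; `X_Q = Γ·x₀` (all level-`Q` handlebody shadows,
`= Γ/Stab(x₀)`); `A = Stab x₀`, `B = Stab x₁`; candidates `C_Q = A·x₂ ∩ B·x₂ ∩ {E : E(N₀) ∩ E(N₁) ∩ E = {1}}`;
`GATE(Q) :⟺ C_Q ⊆ (A∩B)·x₂` (then, by `shadowStandardAt_of_levelGate`, every (3;1) group trisection of `{1}` with
standard pairs has standard shadow at `M_Q`). Product levels `M_{Q₁} ∩ M_{Q₂}` are run as disjoint unions of point sets.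
ALGORITHM (gate.g v4, no enumeration of `X_Q`): set stabilisers `SA, SB, SC` of `E(Nᵢ)` by partition backtrack in
degree `|Hom/Aut Q|`; the `(A∩B)`-orbits on `A·x₂` are the double cosets `(SA∩SC)\SA/(SA∩SB)`; for each representative
`a`: `E(N₂)^a ∈ B·x₂` iff `RepresentativeAction(SB, E₂, E₂^a, OnSets) ≠ fail`, accepted iff the same with `SA∩SB`.

RESULTS (✓ = computed; local = folder logs `comp/local_gate2_*.log`; kit jobs carry `--workitem`, evidence auto-attached):

| level `Q` | `|Hom/Aut Q|` | `|X_Q|` | `|A·x₂|` | `|A·x₂ ∩ B·x₂|` | `|C_Q|` | `|(A∩B)·x₂|` | `(A∩B)`-orbits on `C_Q` | GATE |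
|---|---|---|---|---|---|---|---|---|
| `ℤ/2` ✓ (local; kit j011913) | 64 | 135 | 56 | 28 | 24 | 24 | 1 | HOLDS |
| `ℤ/3` ✓ (local; kit j011913) | 365 | 1120 | 351 | 126 | 108 | 108 | 1 | HOLDS |
| `ℤ/4` (kit j011913) | 2080 | 8640 | | | | | | pending |
| `S₃` (kit j011913; `|X_{S₃}| > 1.5·10⁶`, local count), `D₄`, `Q₈` (kit j011923) | 2948, ·, · | | | | | | | pending |
| `ℤ/8`, `ℤ/9`, `A₄`, `Dic₃` (kit j011924) | | | | | | | | pending |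
| `S₃+ℤ/4`, `D₄+ℤ/3`, `Q₈+ℤ/3`, `S₃+Q₈` (kit j011925) | | | | | | | | pending |
| `D₁₆`, `Q₁₆`, `SD₁₆`, `M₁₆`, `ℤ/4⋊ℤ/4` (kit j011926) | | | | | | | | pending |

At `ℤ/2`, `ℤ/3`: `|C_Q| = q³(q+1)` (triager 1's count of admissible third Lagrangians) and ONE orbit — the abelian gate;
the `(A∩B)`-orbits on `A·x₂ ∩ B·x₂` WITHOUT the triple condition are `3` (sizes `1,3,24` / `6,12,108`): the extra two
are finding 5's witnesses (third Lagrangian through `L₀ ∩ L₁`), killed exactly by the triple condition.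

### 7.3 Reading

* Wherever GATE(Q) HOLDS, the crux at `(m = 0, M_Q)` is TRUE for every `K` (given WaldhausenPairs) — no genus-3 kill is
  possible at that level, for ANY candidate; this supersedes cycle 1's candidate-by-candidate `T_Q` comparisons.
* A level where GATE(Q) FAILS is a "formal fake 4-sphere shadow": it kills, at that level, every K-FREE line
  (prym-layer `LT(M,p)`, the reservoir lemma of finitary-ac, semisimple-venn's cell-wise monodromy, the mod-`e` gate,
  TwistAbsorption with level stabilisers), and it localises the honest hunt: is the fake `y` of the form `E(a N₂)` with
  `a ∈ Stab(N₀)` (true stabiliser), `S/(N₁·aN₂) ≅ ℤ` (⇒ standard pair by Waldhausen–Perelman) and `N₀N₁a(N₂) = S`?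
  Such an `a` gives `¬ShadowsStandard` — and a non-standard genus-3 trisection of a homotopy 4-sphere (§1).
* Redundancies: `M_{Q×T} = M_Q` whenever `T ≤ Q` (`S₃+ℤ/3 ≡ S₃`, `D₆ ≡ S₃`, `ℤ/2×ℤ/4 ≡ ℤ/4`); for coprime abelian
  `Q₁, Q₂` the gate at `M_{Q₁} ∩ M_{Q₂}` follows from the two gates (`Γ` is the full product by strong approximation).
  Genuine simultaneity tests: `S₃+ℤ/4`, `D₄+ℤ/3`, `Q₈+ℤ/3`, `S₃+Q₈`, ….
* `m ≥ 1` is out of enumeration range except abelian `Q` (`|Hom(S_6,Q)| = |Q|^{11} Σ_χ χ(1)^{-10}`), where the gate is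
  Witt-type symplectic linear algebra (the Kashiwara–Wall space `(L₀∩(L₁+L₂))/((L₀∩L₁)+(L₀∩L₂))` has dimension
  `g − 3k = 0` for homotopy-sphere numerics, so balanced triples over a field form one `Sp`-orbit at every genus).

### 7.4 Structure of the `S₃` level (for the Prym lines)

`Hom(S_3,S₃) = 729` (into `A₃`) `+ 63·243` (for each `ε ∈ H¹(S;F₂)∖0` the `3⁵` cocycles in `Z¹(S;F₃^ε)`,
`dim H¹(S;F₃^ε) = 4`, `dim B¹ = 1`) `= 16038`; modulo `Aut S₃`: `365 + 63·41 = 2948`. `E(N₀) = 14 + 7·5 = 49`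
(`ε ∈ ann(L₀)∖0`, `W₀^ε := H¹(F₃;F₃^ε)` a Lagrangian PLANE of the symplectic 4-space `V_ε = H¹(S;F₃^ε)`).
For a triple only SINGLE (`5` ε's per handlebody) and PAIR (`ε_{ij}` spanning `ann Lᵢ ∩ ann Lⱼ`) Prym data occur, never
triple (`ann L₀ ∩ ann L₁ ∩ ann L₂ = 0`) — the `S₃` gate is the first test of SIMULTANEOUS realisability, by one element
of the level group `A∩B`, of the mod-2 and mod-3 Lagrangian alignments and the Prym-plane alignments in `V_{ε₀₂}`,
`V_{ε₁₂}` and the five single `V_ε`.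
-/

end Summit.SmoothPoincare4.SmoothPoincare4.Cruxes.ShadowsStandard.Disproof

end
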